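import Summits.QuantumFields.YangMills.Theorems.BalabanUVNodesN15BackgroundUnitWords
import HarnessLib

/-!
# Route «BalabanUVNodes» (K4 «SpineRates»), node N15 = NE2 — THE SITE AND UNIT LAYERS WITH THE BACKGROUND LIVE, RELATIVE FORM: `K = K₀ + P` with `K₀` an ABSTRACT `U ≡ 1`
# site ∕ unit form carrying NE2⁰-TYPE data (a decaying inverse `W`, `K₀W = 1`, and an η-defect letter `𝔇(K₀′, K₀)` — King's PRINTED A = 0 template) and `P` the DRESSING
# WORDS of the lineage's piece (`siteForm − siteForm₀`, `unitForm − unitForm₀`): ★ `hasMaj_idef_dressedRel`, ★★ `hasMaj_idef_dressedUnitRel`, ★★ `hasMaj_idef_dressedSiteRel`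

Cell `pub-ymgap`, seat `pub-ymgap-dag-n15-c` (generation g5; R134 ACCELERATION SEAT, strategy s1; HUMAN RULING D-0062; chair R424 venue; `bears_on: R4∕N15`).  Filed
`--supports stmt-QuantumFields-20292 --as helper` (K3⁗; count-neutral).  Imports this seat's U1 `…N15BackgroundUnitWords` (S1–S4 through it) BY NAME; nothing in the tree is modified.

WHY (the seat's own HONESTY CAVEAT, bus 2026-08-27 ≈08:40Z).  S4∕U1 dress the PIECE's own `U ≡ 1` forms `QG²Q*`, `a − a²QGQ*` and display THEIR inverses; for the lineage's single-scale
vector piece the uniform invertibility of `a − a²Q(G⊗1)Q*` is UNVERIFIED (King's `C^{(k)} = (a − a²QG_kQ*)⁻¹` concerns the FULL `G_k`), so those displayed data may be vacuous.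
The repair is the print's own logic NE2⁺ = NE2⁰ + dressing: let the `U ≡ 1` form `K₀` be ABSTRACT — whatever the `U ≡ 1` theory's true site ∕ unit form is (for King's scalar tower:
`Δ^{(k)}`, with `C^{(k)}` its decaying inverse and Lemma 4.5 (4.38) its η-rate, all tree theorems of n15-d∕-e) — entering through THREE `U ≡ 1` letters (inverse majorant, `K₀W = 1`,
η-defect `𝔇(K₀′, K₀) ≤ M₀θ·e^{−δd}`), and add the DRESSING `P(A′) := K_piece(A′) − K_piece(0)` computed from the lineage's dressed piece (its majorant and Leibniz defect are U1∕S2,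
plus the piece's own `U ≡ 1` defect `𝔇(unitForm₀′, unitForm₀) = −a²·Q′𝔇(G′,G)Q*`, `𝔇(siteForm₀′, siteForm₀) = Q′𝔇(G′², G²)Q*` proved here).  S1's exact inverse rule then gives the
η-defect of `(K₀ + P)⁻¹` — no piece-specific invertibility is displayed.

CONTENTS ([folklore]: finite-dimensional linear algebra + the lineage's lemmas BY NAME; 2 defs).
* §1 `hasMaj_idef_unitForm₀` (`≤ a²m·e^{−δd}`, no rate loss), `hasMaj_idef_siteForm₀` (`≤ 2βmc_r·e^{−ρd}`).
* §2 ★ `hasMaj_idef_dressedRel` — S1's `hasMaj_idef_siteInv` for `K = K₀ + P`: `𝔇 ≤ A(M₀ + M_P)Ac_r²·e^{−ρd}`.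
* §3 `uAmpRel`, ★★ `hasMaj_idef_dressedUnitRel`; `sAmpRel`, ★★ `hasMaj_idef_dressedSiteRel` — from the `U ≡ 1` layer, the three perturbation letters, the species letters, uniform fibres,
  and the THREE NE2⁰-type letters of the abstract `U ≡ 1` form.

HONEST FRAMING ∕ LIMITS.  MECHANISM over binders; the abstract `U ≡ 1` form `K₀` and its three letters are hypotheses BY DESIGN (the A = 0 layer — printed template [King1986] Lemma 4.5;
for Bałaban's objects NOT PRINTED); nothing about Bałaban's `(Q′G′²Q′*)⁻¹(U)`, `C^{(k)}(Λ;U)` is asserted; NE2⁺ NOT PRINTED, NOT proved; count-neutral (typed 28∕28; discharged count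
unchanged); N15 NOT discharged; one finite T⁴ at fixed ε — NOT infinite volume, NOT OS on ℝ⁴, NOT a mass gap, NOT Clay.
-/

noncomputable section

namespace Summit.QuantumFields.YangMills.BalabanUVNodes.N15.SiteLayer

open Literature.MathematicalPhysics.QuantumFieldTheory.Balaban1983to89
open Literature.MathematicalPhysics.QuantumFieldTheory.Balaban1983to89.B11SectG (BlockNorm HasMaj hasMaj_comp hasMaj_comp_exp RowSum)
open Literature.MathematicalPhysics.QuantumFieldTheory.Balaban1983to89.T4EtaRateDefect (idef idef_comp idef_add idef_sub idef_apply)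
open Literature.MathematicalPhysics.QuantumFieldTheory.Balaban1983to89.T4EtaRateCoeffDefect (pull pull_apply diagK diagK_nonneg diagK_mono fibre
  hasMaj_pull hasMaj_mulOp)
open Literature.MathematicalPhysics.QuantumFieldTheory.Balaban1983to89.B6RandomWalk (Triangle254)
open Literature.MathematicalPhysics.QuantumFieldTheory.Balaban1983to89.B6Prop26Gluing (mulOp mulOp_apply)
open Summit.QuantumFields.YangMills.BalabanUVNodes.N15.BackgroundModel (kappa_ofBlocks)
open Summit.QuantumFields.YangMills.BalabanUVNodes.N15.BackgroundLayer (fibAvg fibAvg_pull_apply idef_fibAvg_eq_zero idef_pull_eq_zero hasMaj_fibAvg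
  hasMaj_add_diagK blkPair liftPair bgConst bgConst_nonneg)

/-! ## §1 The η-defects of the piece's own `U ≡ 1` forms -/

section Zero

variable {X X' Y : Type} [Fintype X] [Fintype X'] [Fintype Y] [DecidableEq X] [DecidableEq Y] {g : B6.Geometry} {σ cr : ℝ}

omit [Fintype Y] in
/-- `𝔇(a − a²Q′G′Q′*, a − a²QGQ*) = −a²·Q′∘𝔇(G′, G)∘Q*` (uniform pairing fibres: `Q′τ = Q`, `Q′* = τQ*`). [folklore] -/
theorem idef_unitForm₀_eq (q : X → Y) (π : X' → X) {N : ℕ} (hN : N ≠ 0) (hfib : ∀ x, (fibre π x).card = N) (a : ℝ)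
    (G : (X → ℝ) →ₗ[ℝ] (X → ℝ)) (G' : (X' → ℝ) →ₗ[ℝ] (X' → ℝ)) :
    idef LinearMap.id LinearMap.id (unitForm₀ a (q ∘ π) G') (unitForm₀ a q G) =
      -(mulOp (fun _ : Y => a * a) ∘ₗ (fibAvg (q ∘ π) ∘ₗ (idef (pull π) (pull π) G' G ∘ₗ pull q))) := by
  have h1 : ∀ u : X → ℝ, fibAvg (q ∘ π) (pull π u) = fibAvg q u := fibAvg_pull_apply q π hN hfib
  refine LinearMap.ext fun v => funext fun y => ?_
  have h2 : pull (q ∘ π) v = pull π (pull q v) := rfl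
  simp only [unitForm₀, idef_apply, LinearMap.sub_apply, LinearMap.comp_apply, LinearMap.neg_apply, LinearMap.id_apply, map_sub, mulOp_apply, Pi.sub_apply,
    Pi.neg_apply, h2, h1]
  ring

/-- **`𝔇(unitForm₀′, unitForm₀) ≤ a²·m·e^{−δd}`** from `𝔇(G′, G) ≤ m·e^{−δd}` (no rate loss). [cite: King1986, (4.33) p.673 (shape)] -/
theorem hasMaj_idef_unitForm₀ (blk : X → g.Site) (blkY : Y → g.Site) (q : X → Y) (π : X' → X) (hq : ∀ x, blk x = blkY (q x)) {N : ℕ} (hN : N ≠ 0)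
    (hfib : ∀ x, (fibre π x).card = N) (a : ℝ) {G : (X → ℝ) →ₗ[ℝ] (X → ℝ)} {G' : (X' → ℝ) →ₗ[ℝ] (X' → ℝ)} {m δ : ℝ} (hm : 0 ≤ m)
    (hDG : HasMaj (BlockNorm.ofBlocks g blk) (BlockNorm.ofBlocks g (blk ∘ π)) (idef (pull π) (pull π) G' G) (fun y y' => m * Real.exp (-(δ * g.dist y y')))) :
    HasMaj (BlockNorm.ofBlocks g blkY) (BlockNorm.ofBlocks g blkY) (idef LinearMap.id LinearMap.id (unitForm₀ a (q ∘ π) G') (unitForm₀ a q G))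
      (fun y y' => a * a * m * Real.exp (-(δ * g.dist y y'))) := by
  have hblk : blk = blkY ∘ q := funext hq
  subst hblk
  have hQ' := hasMaj_fibAvg (g := g) ((blkY ∘ q) ∘ π) blkY (q ∘ π) fun _ => rfl
  have hQs : HasMaj (BlockNorm.ofBlocks g blkY) (BlockNorm.ofBlocks g (blkY ∘ q)) (pull q) (diagK fun _ => 1) := hasMaj_pull blkY q
  have h1 : HasMaj (BlockNorm.ofBlocks g blkY) (BlockNorm.ofBlocks g ((blkY ∘ q) ∘ π)) (idef (pull π) (pull π) G' G ∘ₗ pull q)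
      (fun y y' => m * 1 * Real.exp (-(δ * g.dist y y'))) := hasMaj_exp_comp_diagK (blkY ∘ q) hm hDG hQs
  have h2 := hasMaj_diagK_comp_exp ((blkY ∘ q) ∘ π) zero_le_one hQ' h1
  have hA : HasMaj (BlockNorm.ofBlocks g blkY) (BlockNorm.ofBlocks g blkY) (mulOp fun _ : Y => a * a) (diagK fun _ => a * a) :=
    hasMaj_mulOp blkY (fun _ => mul_self_nonneg a) fun _ => (abs_mul_self a).le
  have h3 := hasMaj_diagK_comp_exp blkY (mul_self_nonneg a) hA h2
  rw [idef_unitForm₀_eq q π hN hfib]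
  exact h3.neg.mono fun y y' => le_of_eq (by ring)

/-- `𝔇(Q′G′²Q′*, QG²Q*) = Q′∘𝔇(G′², G²)∘Q*` and **`≤ 2βmc_r·e^{−ρd}`** (`G, G′ ≤ β·e^{−δd}`, `𝔇(G′, G) ≤ m·e^{−δd}`, `ρ + σ ≤ δ`). [cite: Balaban1985BackgroundPropagators, Thm 3.2 (3.48) p.398 (shape); (3.65) p.403 (mechanism)] -/
theorem hasMaj_idef_siteForm₀ (htri : Triangle254 g) (hd : ∀ a b : g.Site, 0 ≤ g.dist a b) (hrow : RowSum g σ cr) (blk : X → g.Site) (blkY : Y → g.Site)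
    (q : X → Y) (π : X' → X) (hq : ∀ x, blk x = blkY (q x)) {N : ℕ} (hN : N ≠ 0) (hfib : ∀ x, (fibre π x).card = N)
    {G : (X → ℝ) →ₗ[ℝ] (X → ℝ)} {G' : (X' → ℝ) →ₗ[ℝ] (X' → ℝ)} {β m δ ρ : ℝ} (hβ : 0 ≤ β) (hm : 0 ≤ m) (hρ : 0 ≤ ρ) (hρδ : ρ + σ ≤ δ) (hσ : 0 ≤ σ)
    (hG : HasMaj (BlockNorm.ofBlocks g blk) (BlockNorm.ofBlocks g blk) G (fun y y' => β * Real.exp (-(δ * g.dist y y'))))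
    (hG' : HasMaj (BlockNorm.ofBlocks g (blk ∘ π)) (BlockNorm.ofBlocks g (blk ∘ π)) G' (fun y y' => β * Real.exp (-(δ * g.dist y y'))))
    (hDG : HasMaj (BlockNorm.ofBlocks g blk) (BlockNorm.ofBlocks g (blk ∘ π)) (idef (pull π) (pull π) G' G) (fun y y' => m * Real.exp (-(δ * g.dist y y')))) :
    HasMaj (BlockNorm.ofBlocks g blkY) (BlockNorm.ofBlocks g blkY) (idef LinearMap.id LinearMap.id (siteForm₀ (q ∘ π) G') (siteForm₀ q G))
      (fun y y' => 2 * β * m * cr * Real.exp (-(ρ * g.dist y y'))) := by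
  have hblk : blk = blkY ∘ q := funext hq
  subst hblk
  have hQ' := hasMaj_fibAvg (g := g) ((blkY ∘ q) ∘ π) blkY (q ∘ π) fun _ => rfl
  have hQs : HasMaj (BlockNorm.ofBlocks g blkY) (BlockNorm.ofBlocks g (blkY ∘ q)) (pull q) (diagK fun _ => 1) := hasMaj_pull blkY q
  -- 𝔇(G′(G′Q′*), G(GQ*)) = G′𝔇(G′Q′*, GQ*) + 𝔇(G′,G)(GQ*),  𝔇(G′Q′*, GQ*) = G′·0 + 𝔇(G′,G)Q*
  have e1 : idef LinearMap.id (pull π) (G' ∘ₗ pull (q ∘ π)) (G ∘ₗ pull q) = idef (pull π) (pull π) G' G ∘ₗ pull q := by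
    rw [idef_comp LinearMap.id (pull π) (pull π), idef_pull_eq_zero q π, LinearMap.comp_zero, zero_add]
  have hA1 : HasMaj (BlockNorm.ofBlocks g blkY) (BlockNorm.ofBlocks g ((blkY ∘ q) ∘ π)) (idef LinearMap.id (pull π) (G' ∘ₗ pull (q ∘ π)) (G ∘ₗ pull q))
      (fun y y' => m * 1 * Real.exp (-(δ * g.dist y y'))) := by
    rw [e1]; exact hasMaj_exp_comp_diagK (blkY ∘ q) hm hDG hQs
  have hA2 := hasMaj_comp_exp (b₁ := BlockNorm.ofBlocks g blkY) (b₂ := BlockNorm.ofBlocks g ((blkY ∘ q) ∘ π)) (b₃ := BlockNorm.ofBlocks g ((blkY ∘ q) ∘ π))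
    htri hd hrow hβ (by simpa using hm : 0 ≤ m * 1) hρ (by linarith) hρδ hG' hA1
  have hGQ : HasMaj (BlockNorm.ofBlocks g blkY) (BlockNorm.ofBlocks g (blkY ∘ q)) (G ∘ₗ pull q) (fun y y' => β * 1 * Real.exp (-(δ * g.dist y y'))) :=
    hasMaj_exp_comp_diagK (blkY ∘ q) hβ hG hQs
  have hA3 := hasMaj_comp_exp (b₁ := BlockNorm.ofBlocks g blkY) (b₂ := BlockNorm.ofBlocks g (blkY ∘ q)) (b₃ := BlockNorm.ofBlocks g ((blkY ∘ q) ∘ π))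
    htri hd hrow hm (by simpa using hβ : 0 ≤ β * 1) hρ (by linarith) hρδ hDG hGQ
  have hA4 : HasMaj (BlockNorm.ofBlocks g blkY) (BlockNorm.ofBlocks g ((blkY ∘ q) ∘ π))
      (idef LinearMap.id (pull π) (G' ∘ₗ (G' ∘ₗ pull (q ∘ π))) (G ∘ₗ (G ∘ₗ pull q)))
      (fun y y' => ((BlockNorm.ofBlocks g ((blkY ∘ q) ∘ π)).κ * β * (m * 1) * cr + (BlockNorm.ofBlocks g (blkY ∘ q)).κ * m * (β * 1) * cr) *
        Real.exp (-(ρ * g.dist y y'))) := by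
    rw [idef_comp LinearMap.id (pull π) (pull π)]
    exact hasMaj_add_exp hA2 hA3
  have hA5 := hasMaj_diagK_comp_exp ((blkY ∘ q) ∘ π) zero_le_one hQ' hA4
  unfold siteForm₀
  rw [idef_comp LinearMap.id (pull π) LinearMap.id, idef_fibAvg_eq_zero q π hN hfib, LinearMap.zero_comp, add_zero]
  refine hA5.mono fun y y' => le_of_eq ?_
  simp only [kappa_ofBlocks]
  ring

end Zero

/-! ## §2 The relative device: `K = K₀ + P` -/

section Rel

variable {Y : Type} [Fintype Y] [DecidableEq Y] {g : B6.Geometry} (blkY : Y → g.Site) {σ cr : ℝ}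

/-- **THE η-DEFECT OF `(K₀ + P)⁻¹` FROM THE NE2⁰-TYPE LETTERS OF `K₀` AND THE DRESSING LETTERS OF `P`** — S1's `hasMaj_idef_siteInv` with `K := K₀ + P`: `W, W′ ≤ β_W·e^{−δd}`,
`K₀W = 1 = K₀′W′`, `𝔇(K₀′, K₀) ≤ M₀·e^{−δd}`; `P, P′ ≤ R·e^{−δd}`, `𝔇(P′, P) ≤ M_P·e^{−δd}`; `q = β_WRc_r² < 1`, `ρ + 3σ ≤ δ` ⟹ `𝔇 ≤ A(M₀ + M_P)Ac_r²·e^{−ρd}`, `A = β_W(1 − q)⁻¹`.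
[cite: Balaban1985BackgroundPropagators, (3.65)–(3.67) p.403 (mechanism); King1986, Lemma 4.5 (4.38) p.674 (the A = 0 letter's template)] -/
theorem hasMaj_idef_dressedRel (htri : Triangle254 g) (hd : ∀ a b : g.Site, 0 ≤ g.dist a b) (hrow : RowSum g σ cr) (hσ : 0 ≤ σ) (hcr : 0 ≤ cr)
    {W K₀ P W' K₀' P' : (Y → ℝ) →ₗ[ℝ] (Y → ℝ)} {β R M₀ MP δ ρ : ℝ} (hβ : 0 ≤ β) (hR : 0 ≤ R) (hM₀ : 0 ≤ M₀) (hMP : 0 ≤ MP) (hρ : 0 ≤ ρ) (hρδ : ρ + 3 * σ ≤ δ)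
    (hW : HasMaj (BlockNorm.ofBlocks g blkY) (BlockNorm.ofBlocks g blkY) W (fun y y' => β * Real.exp (-(δ * g.dist y y'))))
    (hW' : HasMaj (BlockNorm.ofBlocks g blkY) (BlockNorm.ofBlocks g blkY) W' (fun y y' => β * Real.exp (-(δ * g.dist y y'))))
    (hKW : K₀ ∘ₗ W = LinearMap.id) (hKW' : K₀' ∘ₗ W' = LinearMap.id)
    (hDK₀ : HasMaj (BlockNorm.ofBlocks g blkY) (BlockNorm.ofBlocks g blkY) (idef LinearMap.id LinearMap.id K₀' K₀) (fun y y' => M₀ * Real.exp (-(δ * g.dist y y'))))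
    (hP : HasMaj (BlockNorm.ofBlocks g blkY) (BlockNorm.ofBlocks g blkY) P (fun y y' => R * Real.exp (-(δ * g.dist y y'))))
    (hP' : HasMaj (BlockNorm.ofBlocks g blkY) (BlockNorm.ofBlocks g blkY) P' (fun y y' => R * Real.exp (-(δ * g.dist y y'))))
    (hDP : HasMaj (BlockNorm.ofBlocks g blkY) (BlockNorm.ofBlocks g blkY) (idef LinearMap.id LinearMap.id P' P) (fun y y' => MP * Real.exp (-(δ * g.dist y y'))))
    (hq : β * R * cr * cr < 1) :
    HasMaj (BlockNorm.ofBlocks g blkY) (BlockNorm.ofBlocks g blkY) (idef LinearMap.id LinearMap.id (siteInv W' K₀' (K₀' + P')) (siteInv W K₀ (K₀ + P)))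
      (fun y y' => β * (1 - β * R * cr * cr)⁻¹ * (M₀ + MP) * (β * (1 - β * R * cr * cr)⁻¹) * cr * cr * Real.exp (-(ρ * g.dist y y'))) := by
  have hC : HasMaj (BlockNorm.ofBlocks g blkY) (BlockNorm.ofBlocks g blkY) (K₀ + P - K₀) (fun y y' => R * Real.exp (-(δ * g.dist y y'))) :=
    hP.congr fun μ => by rw [add_sub_cancel_left]
  have hC' : HasMaj (BlockNorm.ofBlocks g blkY) (BlockNorm.ofBlocks g blkY) (K₀' + P' - K₀') (fun y y' => R * Real.exp (-(δ * g.dist y y'))) :=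
    hP'.congr fun μ => by rw [add_sub_cancel_left]
  have hDK : HasMaj (BlockNorm.ofBlocks g blkY) (BlockNorm.ofBlocks g blkY) (idef LinearMap.id LinearMap.id (K₀' + P') (K₀ + P))
      (fun y y' => (M₀ + MP) * Real.exp (-(δ * g.dist y y'))) := by
    rw [idef_add]; exact hasMaj_add_exp hDK₀ hDP
  exact hasMaj_idef_siteInv blkY htri hd hrow hσ hcr hβ hR (add_nonneg hM₀ hMP) hρ hρδ hW hW' hC hC' hDK hKW hKW' hq

end Rel

/-! ## §3 From the letters: the dressed unit and site inverses relative to an abstract `U ≡ 1` form -/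

section Letters

/-- THE AMPLITUDE of the relative unit-covariance η-defect per unit rate `θ`: S1 at `A = β_W(1 − β_W·a²cAmpU·c_r²)⁻¹` with `M = M₀ + M_words + a²m₀` (all `·θ`). [folklore] -/
def uAmpRel (β R cr r m₀ K a₀ o₀ βW a M₀ : ℝ) : ℝ :=
  βW * (1 - βW * (a * a * cAmpU β R cr r) * cr * cr)⁻¹ *
    (M₀ + (a * a * ((1 + r) * (xAmp β R cr * o₀ + bgConst β cr m₀ K a₀ * (1 + r)) + o₀ * (xAmp β R cr * (1 + r))) + a * a * m₀)) *
    (βW * (1 - βW * (a * a * cAmpU β R cr r) * cr * cr)⁻¹) * cr * cr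

/-- `uAmpRel ≥ 0` below the two thresholds. [folklore] -/
theorem uAmpRel_nonneg {β R cr r m₀ K a₀ o₀ βW a M₀ : ℝ} (hβ : 0 ≤ β) (hcr : 0 ≤ cr) (hr : 0 ≤ r) (hm₀ : 0 ≤ m₀) (hK : 0 ≤ K) (ha₀ : 0 ≤ a₀) (ho₀ : 0 ≤ o₀)
    (hβW : 0 ≤ βW) (hM₀ : 0 ≤ M₀) (hq1 : β * R * cr < 1) (hq2 : βW * (a * a * cAmpU β R cr r) * cr * cr < 1) :
    0 ≤ uAmpRel β R cr r m₀ K a₀ o₀ βW a M₀ := by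
  have hx := xAmp_nonneg hβ hq1
  have hb := bgConst_nonneg hβ hcr hm₀ hK ha₀
  have hA : 0 ≤ βW * (1 - βW * (a * a * cAmpU β R cr r) * cr * cr)⁻¹ := mul_nonneg hβW (inv_nonneg.2 (by linarith))
  have ha2 : 0 ≤ a * a := mul_self_nonneg a
  unfold uAmpRel; positivity

variable {X X' Y J : Type} [Fintype X] [Fintype X'] [Fintype Y] [Fintype J] [DecidableEq X] [DecidableEq X'] [DecidableEq Y] [DecidableEq J] {g : B6.Geometry}
  {σ cr : ℝ}
variable {G : (X → ℝ) →ₗ[ℝ] (X → ℝ)} {D : J → (X → ℝ) →ₗ[ℝ] (X → ℝ)} {G' : (X' → ℝ) →ₗ[ℝ] (X' → ℝ)} {D' : J → (X' → ℝ) →ₗ[ℝ] (X' → ℝ)}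
  {V : (X × Option J → ℝ) →ₗ[ℝ] (X → ℝ)} {V' : (X' × Option J → ℝ) →ₗ[ℝ] (X' → ℝ)}
  {F : (X → ℝ) →ₗ[ℝ] (Y → ℝ)} {Fs : (Y → ℝ) →ₗ[ℝ] (X → ℝ)} {F' : (X' → ℝ) →ₗ[ℝ] (Y → ℝ)} {Fs' : (Y → ℝ) →ₗ[ℝ] (X' → ℝ)}
  {W W' Ku Ku' : (Y → ℝ) →ₗ[ℝ] (Y → ℝ)}

/-- **THE η-DEFECT OF THE DRESSED UNIT COVARIANCES RELATIVE TO AN ABSTRACT `U ≡ 1` UNIT FORM, FROM THE LETTERS.**  U1's `hasMaj_idef_dressedUnit` with the piece's `U ≡ 1` form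
`unitForm₀` replaced by ABSTRACT forms `Ku, Ku′` carrying the three NE2⁰-type letters (`W, W′ ≤ β_W·e^{−δd}`, `Ku W = 1 = Ku′W′`, `𝔇(Ku′, Ku) ≤ M₀θ·e^{−δd}`), the dressed form
being `Ku + (unitForm a q F Fs X − unitForm₀ a q G)`, `X = dressedOp G D V̂`: `𝔇 ≤ uAmpRel·θ·e^{−(δ−4σ)d}`. [cite: King1986, (4.33) p.673, Lemma 4.5 (4.38) p.674 (shapes); Balaban1985BackgroundPropagators, (3.65)–(3.67) p.403 (mechanism)] -/
theorem hasMaj_idef_dressedUnitRel (htri : Triangle254 g) (hd : ∀ a b : g.Site, 0 ≤ g.dist a b) (hrow : RowSum g σ cr) (hσ : 0 ≤ σ) (hcr : 0 ≤ cr)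
    (blk : X → g.Site) (blkY : Y → g.Site) (q : X → Y) (π : X' → X) (hq : ∀ x, blk x = blkY (q x)) {N : ℕ} (hN : N ≠ 0)
    (hfib : ∀ x, (fibre π x).card = N) (a : ℝ)
    {δ β m₀ θ K a₀ R r o₀ βW M₀ : ℝ} (hσδ : 4 * σ ≤ δ) (hβ : 0 ≤ β) (hm₀ : 0 ≤ m₀) (hθ : 0 ≤ θ) (hK : 0 ≤ K) (ha₀ : 0 ≤ a₀)
    (hq1 : β * (K * a₀) * cr ≤ 1 / 2) (hR0 : 0 ≤ R) (hRa : R ≤ K * a₀) (hr : 0 ≤ r) (ho₀ : 0 ≤ o₀) (hβW : 0 ≤ βW) (hM₀ : 0 ≤ M₀)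
    (hq2 : βW * (a * a * cAmpU β R cr r) * cr * cr ≤ 1 / 2)
    (hG : HasMaj (BlockNorm.ofBlocks g blk) (BlockNorm.ofBlocks g blk) G (fun y y' => β * Real.exp (-(δ * g.dist y y'))))
    (hD : ∀ μ, HasMaj (BlockNorm.ofBlocks g blk) (BlockNorm.ofBlocks g blk) (D μ) (fun y y' => β * Real.exp (-(δ * g.dist y y'))))
    (hG' : HasMaj (BlockNorm.ofBlocks g (blk ∘ π)) (BlockNorm.ofBlocks g (blk ∘ π)) G' (fun y y' => β * Real.exp (-(δ * g.dist y y'))))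
    (hD' : ∀ μ, HasMaj (BlockNorm.ofBlocks g (blk ∘ π)) (BlockNorm.ofBlocks g (blk ∘ π)) (D' μ) (fun y y' => β * Real.exp (-(δ * g.dist y y'))))
    (hDG : HasMaj (BlockNorm.ofBlocks g blk) (BlockNorm.ofBlocks g (blk ∘ π)) (idef (pull π) (pull π) G' G)
      (fun y y' => m₀ * θ * Real.exp (-(δ * g.dist y y'))))
    (hDD : ∀ μ, HasMaj (BlockNorm.ofBlocks g blk) (BlockNorm.ofBlocks g (blk ∘ π)) (idef (pull π) (pull π) (D' μ) (D μ))
      (fun y y' => m₀ * θ * Real.exp (-(δ * g.dist y y'))))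
    (hV : HasMaj (BlockNorm.ofBlocks g (blkPair blk)) (BlockNorm.ofBlocks g blk) V (diagK fun _ => R))
    (hV' : HasMaj (BlockNorm.ofBlocks g (blkPair (blk ∘ π))) (BlockNorm.ofBlocks g (blk ∘ π)) V' (diagK fun _ => R))
    (hDV : HasMaj (BlockNorm.ofBlocks g (blkPair blk)) (BlockNorm.ofBlocks g (blk ∘ π)) (idef (pull (liftPair π)) (pull π) V' V)
      (diagK fun _ => R * θ))
    (hF : HasMaj (BlockNorm.ofBlocks g blk) (BlockNorm.ofBlocks g blkY) F (diagK fun _ => r))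
    (hFs : HasMaj (BlockNorm.ofBlocks g blkY) (BlockNorm.ofBlocks g blk) Fs (diagK fun _ => r))
    (hF' : HasMaj (BlockNorm.ofBlocks g (blk ∘ π)) (BlockNorm.ofBlocks g blkY) F' (diagK fun _ => r))
    (hFs' : HasMaj (BlockNorm.ofBlocks g blkY) (BlockNorm.ofBlocks g (blk ∘ π)) Fs' (diagK fun _ => r))
    (hDF : HasMaj (BlockNorm.ofBlocks g blk) (BlockNorm.ofBlocks g blkY) (idef (pull π) LinearMap.id F' F) (diagK fun _ => o₀ * θ))
    (hDFs : HasMaj (BlockNorm.ofBlocks g blkY) (BlockNorm.ofBlocks g (blk ∘ π)) (idef LinearMap.id (pull π) Fs' Fs) (diagK fun _ => o₀ * θ))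
    (hW : HasMaj (BlockNorm.ofBlocks g blkY) (BlockNorm.ofBlocks g blkY) W (fun y y' => βW * Real.exp (-(δ * g.dist y y'))))
    (hW' : HasMaj (BlockNorm.ofBlocks g blkY) (BlockNorm.ofBlocks g blkY) W' (fun y y' => βW * Real.exp (-(δ * g.dist y y'))))
    (hKW : Ku ∘ₗ W = LinearMap.id) (hKW' : Ku' ∘ₗ W' = LinearMap.id)
    (hDKu : HasMaj (BlockNorm.ofBlocks g blkY) (BlockNorm.ofBlocks g blkY) (idef LinearMap.id LinearMap.id Ku' Ku) (fun y y' => M₀ * θ * Real.exp (-(δ * g.dist y y')))) :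
    HasMaj (BlockNorm.ofBlocks g blkY) (BlockNorm.ofBlocks g blkY)
      (idef LinearMap.id LinearMap.id
        (siteInv W' Ku' (Ku' + (unitForm a (q ∘ π) F' Fs' (dressedOp G' D' V') - unitForm₀ a (q ∘ π) G')))
        (siteInv W Ku (Ku + (unitForm a q F Fs (dressedOp G D V) - unitForm₀ a q G))))
      (fun y y' => uAmpRel β R cr r m₀ K a₀ o₀ βW a M₀ * θ * Real.exp (-((δ - 4 * σ) * g.dist y y'))) := by
  have hq' : β * R * cr ≤ 1 / 2 := (mul_le_mul_of_nonneg_right (mul_le_mul_of_nonneg_left hRa hβ) hcr).trans hq1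
  have hqlt : β * R * cr < 1 := by linarith
  have hB : 0 ≤ xAmp β R cr := xAmp_nonneg hβ hqlt
  have hCU : 0 ≤ cAmpU β R cr r := cAmpU_nonneg hβ hR0 hcr hr hqlt
  have hq2lt : βW * (a * a * cAmpU β R cr r) * cr * cr < 1 := by linarith
  have hq'' : ∀ x', (blk ∘ π) x' = blkY ((q ∘ π) x') := fun x' => hq (π x')
  have hX : HasMaj (BlockNorm.ofBlocks g blk) (BlockNorm.ofBlocks g blk) (dressedOp G D V)
      (fun y y' => xAmp β R cr * Real.exp (-((δ - σ) * g.dist y y'))) :=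
    hasMaj_dressedOp blk htri hd hrow hσ (ρ := δ - σ) (by linarith) (by linarith) hβ hR0 hG hD hV hqlt
  have hX' : HasMaj (BlockNorm.ofBlocks g (blk ∘ π)) (BlockNorm.ofBlocks g (blk ∘ π)) (dressedOp G' D' V')
      (fun y y' => xAmp β R cr * Real.exp (-((δ - σ) * g.dist y y'))) :=
    hasMaj_dressedOp (blk ∘ π) htri hd hrow hσ (ρ := δ - σ) (by linarith) (by linarith) hβ hR0 hG' hD' hV' hqlt
  have hE : HasMaj (BlockNorm.ofBlocks g blk) (BlockNorm.ofBlocks g blk) (dressedOp G D V - G)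
      (fun y y' => β * (R * xAmp β R cr) * cr * Real.exp (-((δ - σ) * g.dist y y'))) :=
    hasMaj_dressedOp_sub blk htri hd hrow hσ (ρ := δ - σ) (by linarith) (by linarith) hβ hR0 hG hD hV hqlt
  have hE' : HasMaj (BlockNorm.ofBlocks g (blk ∘ π)) (BlockNorm.ofBlocks g (blk ∘ π)) (dressedOp G' D' V' - G')
      (fun y y' => β * (R * xAmp β R cr) * cr * Real.exp (-((δ - σ) * g.dist y y'))) :=
    hasMaj_dressedOp_sub (blk ∘ π) htri hd hrow hσ (ρ := δ - σ) (by linarith) (by linarith) hβ hR0 hG' hD' hV' hqlt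
  have hDX := hasMaj_idef_dressedOp blk π htri hd hrow hσ hcr (by linarith : σ ≤ δ) hβ hm₀ hθ hq1 hR0 hRa hG hD hG' hD' hDG hDD hV hV' hDV
  have hEamp : 0 ≤ β * (R * xAmp β R cr) * cr := mul_nonneg (mul_nonneg hβ (mul_nonneg hR0 hB)) hcr
  -- the dressing P and its letters at δ − σ
  have hP := hasMaj_unitC blk blkY q hq a hB hEamp hr hX hE hF hFs
  have hP' := hasMaj_unitC (blk ∘ π) blkY (q ∘ π) hq'' a hB hEamp hr hX' hE' hF' hFs'
  have hDK := hasMaj_idef_unitForm blk blkY q π hq hN hfib a hB (mul_nonneg (bgConst_nonneg hβ hcr hm₀ hK ha₀) hθ) hr (mul_nonneg ho₀ hθ)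
    hX' hDX hX hFs hF' hFs' hDF hDFs
  have hDK₀ := hasMaj_idef_unitForm₀ blk blkY q π hq hN hfib a (mul_nonneg hm₀ hθ) hDG
  have hDK₀' : HasMaj (BlockNorm.ofBlocks g blkY) (BlockNorm.ofBlocks g blkY) (idef LinearMap.id LinearMap.id (unitForm₀ a (q ∘ π) G') (unitForm₀ a q G))
      (fun y y' => a * a * (m₀ * θ) * Real.exp (-((δ - σ) * g.dist y y'))) :=
    hasMaj_exp_mono hd (mul_nonneg (mul_self_nonneg a) (mul_nonneg hm₀ hθ)) (by linarith) hDK₀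
  have hDP : HasMaj (BlockNorm.ofBlocks g blkY) (BlockNorm.ofBlocks g blkY)
      (idef LinearMap.id LinearMap.id (unitForm a (q ∘ π) F' Fs' (dressedOp G' D' V') - unitForm₀ a (q ∘ π) G')
        (unitForm a q F Fs (dressedOp G D V) - unitForm₀ a q G))
      (fun y y' => (a * a * ((1 + r) * (xAmp β R cr * (o₀ * θ) + bgConst β cr m₀ K a₀ * θ * (1 + r)) + o₀ * θ * (xAmp β R cr * (1 + r))) +
        a * a * (m₀ * θ)) * Real.exp (-((δ - σ) * g.dist y y'))) := by
    rw [idef_sub]; exact (hDK.sub hDK₀').mono fun y y' => le_of_eq (by ring)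
  have hW₁ : HasMaj (BlockNorm.ofBlocks g blkY) (BlockNorm.ofBlocks g blkY) W (fun y y' => βW * Real.exp (-((δ - σ) * g.dist y y'))) :=
    hasMaj_exp_mono hd hβW (by linarith) hW
  have hW₁' : HasMaj (BlockNorm.ofBlocks g blkY) (BlockNorm.ofBlocks g blkY) W' (fun y y' => βW * Real.exp (-((δ - σ) * g.dist y y'))) :=
    hasMaj_exp_mono hd hβW (by linarith) hW'
  have hDKu₁ : HasMaj (BlockNorm.ofBlocks g blkY) (BlockNorm.ofBlocks g blkY) (idef LinearMap.id LinearMap.id Ku' Ku)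
      (fun y y' => M₀ * θ * Real.exp (-((δ - σ) * g.dist y y'))) := hasMaj_exp_mono hd (mul_nonneg hM₀ hθ) (by linarith) hDKu
  have hMP : 0 ≤ a * a * ((1 + r) * (xAmp β R cr * (o₀ * θ) + bgConst β cr m₀ K a₀ * θ * (1 + r)) + o₀ * θ * (xAmp β R cr * (1 + r))) + a * a * (m₀ * θ) := by
    have := bgConst_nonneg hβ hcr hm₀ hK ha₀; have := mul_self_nonneg a; positivity
  have key := hasMaj_idef_dressedRel blkY htri hd hrow hσ hcr (ρ := δ - 4 * σ) hβW (mul_nonneg (mul_self_nonneg a) hCU) (mul_nonneg hM₀ hθ) hMP (by linarith)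
    (by linarith) hW₁ hW₁' hKW hKW' hDKu₁ (hP.mono fun y y' => le_of_eq (by unfold cAmpU; ring)) (hP'.mono fun y y' => le_of_eq (by unfold cAmpU; ring)) hDP hq2lt
  refine key.mono fun y y' => le_of_eq ?_
  unfold uAmpRel
  ring

/-- THE AMPLITUDE of the relative site-kernel η-defect per unit rate `θ`. [folklore] -/
def sAmpRel (β R cr r m₀ K a₀ o₀ βW M₀ : ℝ) : ℝ :=
  βW * (1 - βW * cAmp β R cr r * cr * cr)⁻¹ *
    (M₀ + 2 * (1 + r) * xAmp β R cr * cr * (xAmp β R cr * o₀ + bgConst β cr m₀ K a₀ * (1 + r)) + 2 * β * m₀ * cr) *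
    (βW * (1 - βW * cAmp β R cr r * cr * cr)⁻¹) * cr * cr

/-- `sAmpRel ≥ 0` below the two thresholds. [folklore] -/
theorem sAmpRel_nonneg {β R cr r m₀ K a₀ o₀ βW M₀ : ℝ} (hβ : 0 ≤ β) (hcr : 0 ≤ cr) (hr : 0 ≤ r) (hm₀ : 0 ≤ m₀) (hK : 0 ≤ K) (ha₀ : 0 ≤ a₀) (ho₀ : 0 ≤ o₀)
    (hβW : 0 ≤ βW) (hM₀ : 0 ≤ M₀) (hq1 : β * R * cr < 1) (hq2 : βW * cAmp β R cr r * cr * cr < 1) : 0 ≤ sAmpRel β R cr r m₀ K a₀ o₀ βW M₀ := by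
  have hx := xAmp_nonneg hβ hq1
  have hb := bgConst_nonneg hβ hcr hm₀ hK ha₀
  have hA : 0 ≤ βW * (1 - βW * cAmp β R cr r * cr * cr)⁻¹ := mul_nonneg hβW (inv_nonneg.2 (by linarith))
  unfold sAmpRel; positivity

/-- **THE η-DEFECT OF THE DRESSED SITE KERNELS RELATIVE TO AN ABSTRACT `U ≡ 1` SITE FORM, FROM THE LETTERS** (S4's `hasMaj_idef_dressedSite` with `Ks, Ks′` abstract: the three
NE2⁰-type letters; dressed form `Ks + (siteForm q F Fs X − siteForm₀ q G)`): `𝔇 ≤ sAmpRel·θ·e^{−(δ−5σ)d}`. [cite: Balaban1985BackgroundPropagators, Thm 3.2 (3.48) p.398, (3.65)–(3.67) p.403 (shapes, mechanism); King1986, Lemma 4.5 (4.38) p.674 (template)] -/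
theorem hasMaj_idef_dressedSiteRel (htri : Triangle254 g) (hd : ∀ a b : g.Site, 0 ≤ g.dist a b) (hrow : RowSum g σ cr) (hσ : 0 ≤ σ) (hcr : 0 ≤ cr)
    (blk : X → g.Site) (blkY : Y → g.Site) (q : X → Y) (π : X' → X) (hq : ∀ x, blk x = blkY (q x)) {N : ℕ} (hN : N ≠ 0)
    (hfib : ∀ x, (fibre π x).card = N)
    {δ β m₀ θ K a₀ R r o₀ βW M₀ : ℝ} (hσδ : 5 * σ ≤ δ) (hβ : 0 ≤ β) (hm₀ : 0 ≤ m₀) (hθ : 0 ≤ θ) (hK : 0 ≤ K) (ha₀ : 0 ≤ a₀)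
    (hq1 : β * (K * a₀) * cr ≤ 1 / 2) (hR0 : 0 ≤ R) (hRa : R ≤ K * a₀) (hr : 0 ≤ r) (ho₀ : 0 ≤ o₀) (hβW : 0 ≤ βW) (hM₀ : 0 ≤ M₀)
    (hq2 : βW * cAmp β R cr r * cr * cr ≤ 1 / 2)
    (hG : HasMaj (BlockNorm.ofBlocks g blk) (BlockNorm.ofBlocks g blk) G (fun y y' => β * Real.exp (-(δ * g.dist y y'))))
    (hD : ∀ μ, HasMaj (BlockNorm.ofBlocks g blk) (BlockNorm.ofBlocks g blk) (D μ) (fun y y' => β * Real.exp (-(δ * g.dist y y'))))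
    (hG' : HasMaj (BlockNorm.ofBlocks g (blk ∘ π)) (BlockNorm.ofBlocks g (blk ∘ π)) G' (fun y y' => β * Real.exp (-(δ * g.dist y y'))))
    (hD' : ∀ μ, HasMaj (BlockNorm.ofBlocks g (blk ∘ π)) (BlockNorm.ofBlocks g (blk ∘ π)) (D' μ) (fun y y' => β * Real.exp (-(δ * g.dist y y'))))
    (hDG : HasMaj (BlockNorm.ofBlocks g blk) (BlockNorm.ofBlocks g (blk ∘ π)) (idef (pull π) (pull π) G' G)
      (fun y y' => m₀ * θ * Real.exp (-(δ * g.dist y y'))))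
    (hDD : ∀ μ, HasMaj (BlockNorm.ofBlocks g blk) (BlockNorm.ofBlocks g (blk ∘ π)) (idef (pull π) (pull π) (D' μ) (D μ))
      (fun y y' => m₀ * θ * Real.exp (-(δ * g.dist y y'))))
    (hV : HasMaj (BlockNorm.ofBlocks g (blkPair blk)) (BlockNorm.ofBlocks g blk) V (diagK fun _ => R))
    (hV' : HasMaj (BlockNorm.ofBlocks g (blkPair (blk ∘ π))) (BlockNorm.ofBlocks g (blk ∘ π)) V' (diagK fun _ => R))
    (hDV : HasMaj (BlockNorm.ofBlocks g (blkPair blk)) (BlockNorm.ofBlocks g (blk ∘ π)) (idef (pull (liftPair π)) (pull π) V' V)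
      (diagK fun _ => R * θ))
    (hF : HasMaj (BlockNorm.ofBlocks g blk) (BlockNorm.ofBlocks g blkY) F (diagK fun _ => r))
    (hFs : HasMaj (BlockNorm.ofBlocks g blkY) (BlockNorm.ofBlocks g blk) Fs (diagK fun _ => r))
    (hF' : HasMaj (BlockNorm.ofBlocks g (blk ∘ π)) (BlockNorm.ofBlocks g blkY) F' (diagK fun _ => r))
    (hFs' : HasMaj (BlockNorm.ofBlocks g blkY) (BlockNorm.ofBlocks g (blk ∘ π)) Fs' (diagK fun _ => r))
    (hDF : HasMaj (BlockNorm.ofBlocks g blk) (BlockNorm.ofBlocks g blkY) (idef (pull π) LinearMap.id F' F) (diagK fun _ => o₀ * θ))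
    (hDFs : HasMaj (BlockNorm.ofBlocks g blkY) (BlockNorm.ofBlocks g (blk ∘ π)) (idef LinearMap.id (pull π) Fs' Fs) (diagK fun _ => o₀ * θ))
    (hW : HasMaj (BlockNorm.ofBlocks g blkY) (BlockNorm.ofBlocks g blkY) W (fun y y' => βW * Real.exp (-(δ * g.dist y y'))))
    (hW' : HasMaj (BlockNorm.ofBlocks g blkY) (BlockNorm.ofBlocks g blkY) W' (fun y y' => βW * Real.exp (-(δ * g.dist y y'))))
    (hKW : Ku ∘ₗ W = LinearMap.id) (hKW' : Ku' ∘ₗ W' = LinearMap.id)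
    (hDKu : HasMaj (BlockNorm.ofBlocks g blkY) (BlockNorm.ofBlocks g blkY) (idef LinearMap.id LinearMap.id Ku' Ku) (fun y y' => M₀ * θ * Real.exp (-(δ * g.dist y y')))) :
    HasMaj (BlockNorm.ofBlocks g blkY) (BlockNorm.ofBlocks g blkY)
      (idef LinearMap.id LinearMap.id
        (siteInv W' Ku' (Ku' + (siteForm (q ∘ π) F' Fs' (dressedOp G' D' V') - siteForm₀ (q ∘ π) G')))
        (siteInv W Ku (Ku + (siteForm q F Fs (dressedOp G D V) - siteForm₀ q G))))
      (fun y y' => sAmpRel β R cr r m₀ K a₀ o₀ βW M₀ * θ * Real.exp (-((δ - 5 * σ) * g.dist y y'))) := by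
  have hq' : β * R * cr ≤ 1 / 2 := (mul_le_mul_of_nonneg_right (mul_le_mul_of_nonneg_left hRa hβ) hcr).trans hq1
  have hqlt : β * R * cr < 1 := by linarith
  have hB : 0 ≤ xAmp β R cr := xAmp_nonneg hβ hqlt
  have hC0 : 0 ≤ cAmp β R cr r := cAmp_nonneg hβ hR0 hcr hr hqlt
  have hq2lt : βW * cAmp β R cr r * cr * cr < 1 := by linarith
  have hq'' : ∀ x', (blk ∘ π) x' = blkY ((q ∘ π) x') := fun x' => hq (π x')
  have hX : HasMaj (BlockNorm.ofBlocks g blk) (BlockNorm.ofBlocks g blk) (dressedOp G D V)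
      (fun y y' => xAmp β R cr * Real.exp (-((δ - σ) * g.dist y y'))) :=
    hasMaj_dressedOp blk htri hd hrow hσ (ρ := δ - σ) (by linarith) (by linarith) hβ hR0 hG hD hV hqlt
  have hX' : HasMaj (BlockNorm.ofBlocks g (blk ∘ π)) (BlockNorm.ofBlocks g (blk ∘ π)) (dressedOp G' D' V')
      (fun y y' => xAmp β R cr * Real.exp (-((δ - σ) * g.dist y y'))) :=
    hasMaj_dressedOp (blk ∘ π) htri hd hrow hσ (ρ := δ - σ) (by linarith) (by linarith) hβ hR0 hG' hD' hV' hqlt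
  have hE : HasMaj (BlockNorm.ofBlocks g blk) (BlockNorm.ofBlocks g blk) (dressedOp G D V - G)
      (fun y y' => β * (R * xAmp β R cr) * cr * Real.exp (-((δ - σ) * g.dist y y'))) :=
    hasMaj_dressedOp_sub blk htri hd hrow hσ (ρ := δ - σ) (by linarith) (by linarith) hβ hR0 hG hD hV hqlt
  have hE' : HasMaj (BlockNorm.ofBlocks g (blk ∘ π)) (BlockNorm.ofBlocks g (blk ∘ π)) (dressedOp G' D' V' - G')
      (fun y y' => β * (R * xAmp β R cr) * cr * Real.exp (-((δ - σ) * g.dist y y'))) :=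
    hasMaj_dressedOp_sub (blk ∘ π) htri hd hrow hσ (ρ := δ - σ) (by linarith) (by linarith) hβ hR0 hG' hD' hV' hqlt
  have hDX := hasMaj_idef_dressedOp blk π htri hd hrow hσ hcr (by linarith : σ ≤ δ) hβ hm₀ hθ hq1 hR0 hRa hG hD hG' hD' hDG hDD hV hV' hDV
  have hG₁ : HasMaj (BlockNorm.ofBlocks g blk) (BlockNorm.ofBlocks g blk) G (fun y y' => β * Real.exp (-((δ - σ) * g.dist y y'))) :=
    hasMaj_exp_mono hd hβ (by linarith) hG
  have hG₁' : HasMaj (BlockNorm.ofBlocks g (blk ∘ π)) (BlockNorm.ofBlocks g (blk ∘ π)) G' (fun y y' => β * Real.exp (-((δ - σ) * g.dist y y'))) :=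
    hasMaj_exp_mono hd hβ (by linarith) hG'
  have hDG₁ : HasMaj (BlockNorm.ofBlocks g blk) (BlockNorm.ofBlocks g (blk ∘ π)) (idef (pull π) (pull π) G' G)
      (fun y y' => m₀ * θ * Real.exp (-((δ - σ) * g.dist y y'))) := hasMaj_exp_mono hd (mul_nonneg hm₀ hθ) (by linarith) hDG
  have hEamp : 0 ≤ β * (R * xAmp β R cr) * cr := mul_nonneg (mul_nonneg hβ (mul_nonneg hR0 hB)) hcr
  -- the dressing P and its letters at δ − 2σ
  have hP := hasMaj_siteC htri hd hrow hσ hcr blk blkY q hq (ρ := δ - 2 * σ) hB hβ hEamp hr (by linarith) (by linarith) hX hG₁ hE hF hFs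
  have hP' := hasMaj_siteC htri hd hrow hσ hcr (blk ∘ π) blkY (q ∘ π) hq'' (ρ := δ - 2 * σ) hB hβ hEamp hr (by linarith) (by linarith)
    hX' hG₁' hE' hF' hFs'
  have hDK := hasMaj_idef_siteForm htri hd hrow hσ blk blkY q π hq hN hfib (ρ := δ - 2 * σ) hB
    (mul_nonneg (bgConst_nonneg hβ hcr hm₀ hK ha₀) hθ) hr (mul_nonneg ho₀ hθ) (by linarith) (by linarith) hX hX' hDX hFs hF' hFs' hDF hDFs
  have hDK₀ := hasMaj_idef_siteForm₀ htri hd hrow blk blkY q π hq hN hfib (ρ := δ - 2 * σ) hβ (mul_nonneg hm₀ hθ) (by linarith) (by linarith) hσ hG₁ hG₁' hDG₁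
  have hDP : HasMaj (BlockNorm.ofBlocks g blkY) (BlockNorm.ofBlocks g blkY)
      (idef LinearMap.id LinearMap.id (siteForm (q ∘ π) F' Fs' (dressedOp G' D' V') - siteForm₀ (q ∘ π) G')
        (siteForm q F Fs (dressedOp G D V) - siteForm₀ q G))
      (fun y y' => (2 * (1 + r) * xAmp β R cr * cr * (xAmp β R cr * (o₀ * θ) + bgConst β cr m₀ K a₀ * θ * (1 + r)) + 2 * β * (m₀ * θ) * cr) *
        Real.exp (-((δ - 2 * σ) * g.dist y y'))) := by
    rw [idef_sub]; exact (hDK.sub hDK₀).mono fun y y' => le_of_eq (by ring)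
  have hW₂ : HasMaj (BlockNorm.ofBlocks g blkY) (BlockNorm.ofBlocks g blkY) W (fun y y' => βW * Real.exp (-((δ - 2 * σ) * g.dist y y'))) :=
    hasMaj_exp_mono hd hβW (by linarith) hW
  have hW₂' : HasMaj (BlockNorm.ofBlocks g blkY) (BlockNorm.ofBlocks g blkY) W' (fun y y' => βW * Real.exp (-((δ - 2 * σ) * g.dist y y'))) :=
    hasMaj_exp_mono hd hβW (by linarith) hW'
  have hDKu₂ : HasMaj (BlockNorm.ofBlocks g blkY) (BlockNorm.ofBlocks g blkY) (idef LinearMap.id LinearMap.id Ku' Ku)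
      (fun y y' => M₀ * θ * Real.exp (-((δ - 2 * σ) * g.dist y y'))) := hasMaj_exp_mono hd (mul_nonneg hM₀ hθ) (by linarith) hDKu
  have hMP : 0 ≤ 2 * (1 + r) * xAmp β R cr * cr * (xAmp β R cr * (o₀ * θ) + bgConst β cr m₀ K a₀ * θ * (1 + r)) + 2 * β * (m₀ * θ) * cr := by
    have := bgConst_nonneg hβ hcr hm₀ hK ha₀; positivity
  have key := hasMaj_idef_dressedRel blkY htri hd hrow hσ hcr (ρ := δ - 5 * σ) hβW hC0 (mul_nonneg hM₀ hθ) hMP (by linarith) (by linarith)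
    hW₂ hW₂' hKW hKW' hDKu₂ (hP.mono fun y y' => le_of_eq (by unfold cAmp; ring)) (hP'.mono fun y y' => le_of_eq (by unfold cAmp; ring)) hDP hq2lt
  refine key.mono fun y y' => le_of_eq ?_
  unfold sAmpRel
  ring

end Letters


end Summit.QuantumFields.YangMills.BalabanUVNodes.N15.SiteLayer

end
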